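/-
COR-CM (cell pub-hodgecm2, stage 2 of the Hodge ladder) — count-neutral KERNEL COMBINATORICS «β − 2 faces for every Galois CM field with dihedral group
of order 4n and complex conjugation the central rotation» (seat prover-pub-hodgecm2-b23-g48-0, binder prover b23, gen 48; own census lane DIHEDRAL LAW,
claim HOME/INBOX.md l.22267).  Theorems only; no geometry beyond the treeʼs `Face`, no `Universe` field touched, no named fact, nothing asserted; the lane
`Census/Dihedral*` (this seat; parts Ia–IV, block count, rows), the generic transfer `CorCM/FaceGenerationTransfer.lean` and the INT2-GEN socket (`CorCM/FacePeriodsGeneratingSet.lean`)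
are used BY NAME; `Interfaces.lean` (C1), every E term, B01, `Transposition/*`, `PortJoin/*`, `D2Bridge/*` are untouched.
HONEST FRAMING (COORDINATOR RULING — HODGE FRAMING CORRECTION, 2026-08-21T11:55:35Z): `HC_CM` is NOT proved, here or anywhere in the tree; this file
produces no period and proves no face period for any field; its `HodgeConjectureFor` statement is CONDITIONAL on face periods.
T5: n/a-class — the only Prop hypothesis binders displayed are the dihedral datum (inhabited: `Census/DihedralInstance.lean`) and INT2-GENʼs period
hypothesis on the produced face set (§3); no named-fact / conjecture-def binder; checker: self (prover-pub-hodgecm2-b23-g48-0), 2026-08-25.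
-/
import Summits.HodgeConjecture.CorCM.Census.DihedralRows
import Summits.HodgeConjecture.CorCM.FaceGenerationTransfer
import Summits.HodgeConjecture.CorCM.FaceCensusOddSliceTransport
import HarnessLib

/-!
# Galois CM fields with dihedral group `D(ℤ/2n)` of order `4n` (conjugation the central rotation): EXACTLY `β − 2 = φ₂` generating faces

Let `F` be a Galois CM field whose Galois translates `GalT F` carry a DIHEDRAL DATUM (`Census/DihedralDatum.lean`, `Dihedral.Datum (GalT F) conjT n`):
a translate `g` of order `2n` with `gⁿ = conjT` generating a subgroup of index two and every translate outside `⟨g⟩` an involution — i.e.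
`Gal(F/ℚ) ≅ D(ℤ/2n) = D_{2n}`, the dihedral group of order `4n`, with complex conjugation its central rotation (`[F:ℚ] = 4n`; e.g. dihedral CM fields
of degree `16` with group `D₈`, of degree `24` with group `D₁₂`, of degree `32` with group `D₁₆`).  For even `n` complex conjugation is a commutator and
a square, `𝒦 = Gal`: none of `CorCM/FaceAbelian*`, `FaceComplement*`, `FaceCyclicGeneration`, `FaceQuarticTwist*`, `FaceDicyclicTwist*`,
`FaceQuarticInversion*`, `FaceOcticProduct*` covers these groups.  Write `β(F) = #Block conjT`.

* §1 **`isLeast_card_faces_hgen_of_dihedral`**: for every base embedding `σ₀` the least size of a finite set `𝒮` of rank-four faces of `F` satisfying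
  INT2-GENʼs generation binder `hgen(𝒮, σ₀)` is **EXACTLY `φ₂(F) = β(F) − 2`** (`…_card_block`); rows: degree `16` (`D₈`) EXACTLY `22`, degree `32`
  (`D₁₆`) EXACTLY `2174` (`isLeast_card_faces_hgen_twentyTwo/_2174`, via `Census/DihedralRows.lean`).  Existence is this seatʼs dihedral law
  (`Census/DihedralLaw.lean`: one coordinate face per block without arc pairs, one arc face per arc-pair block off the two base blocks, INTEGRAL
  generation); the floor is seat b09ʼs coinvariant floor; both are carried to the field by `FaceTransfer.isLeast_card_faces_hgen_of_intrinsic`.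
* §2 the degree (`four_mul_eq_finrank`) and **the datum from the automorphism group** (`exists_datum_of_aut`): a `g₀ ∈ Aut(F)` of order `2n` with
  `g₀ⁿ` inducing complex conjugation at `σ₀`, an `s₀ ∉ ⟨g₀⟩`, all automorphisms outside `⟨g₀⟩` involutions, and `[F:ℚ] = 4n`.
* §3 **`hodgeConjectureFor_of_dihedral_of_exists_facePeriod`** (INT2-GEN socket BY NAME, `n ≥ 2`): a face set with `|𝒮| = φ₂(F)` EXISTS whose periods on
  the universe of record give the Hodge conjecture for every abelian variety dominated by a product of CM abelian varieties with CM by subfields of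
  `F` — CONDITIONAL on those periods; `HC_CM` is NOT proved.

References: [cite: Pohlmann1968, Thm. 1]; [cite: Milne1999LefschetzClasses, Thm. 3.2, Prop. 2.1]; [cite: Shimura1998, §6.2 Theorem 3 and §6.1
Corollary of Theorem 2 (pp. 41–43), §8.1 (p. 62)]; [cite: MumfordAV1970, §19 Thm. 1 and p. 169].
-/

noncomputable section

open CategoryTheory NumberField NumberField.ComplexEmbedding
open Literature.AlgebraicGeometry Literature.AlgebraicGeometry.Motives Literature.AlgebraicGeometry.HodgeTheory
open Literature.AlgebraicGeometry.ComplexMultiplication Literature.AlgebraicGeometry.Milne1999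
open Literature.NumberTheory.Automorphic
open Literature.NumberTheory.Automorphic.PicardCM
open Summit.HodgeConjecture.CorCM.Domination

namespace Summit.HodgeConjecture.CorCM.FaceDihedral

open Summit.HodgeConjecture.CorCM.Prior.AllgGroup.RfwfAllgGroup
open Summit.HodgeConjecture.CorCM.Census.BlockParity
open Summit.HodgeConjecture.CorCM.Census.Coinvariant
open Summit.HodgeConjecture.CorCM.Census
open Summit.HodgeConjecture.CorCM.FaceCensus.OddSlice (galTOfAut galTOfAut_mul galTOfAut_conjAut)

/-! ## §1 Dihedral datum on the Galois translates: exactly `φ₂(F) = β(F) − 2` generating faces -/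

section Field

variable {F : Type} [Field F] [NumberField F] {n : ℕ} [NeZero n]

/-- **EVERY GALOIS CM FIELD WITH DIHEDRAL GROUP OF ORDER `4n` AND CENTRAL-ROTATION CONJUGATION HAS `φ₂` GENERATING FACES, AND NONE FEWER** — the
coinvariant floor is attained. [folklore] -/
theorem isLeast_card_faces_hgen_of_dihedral [IsCMField F] [IsGalois ℚ F] (D : Dihedral.Datum (GalT F) conjT n) (σ₀ : F →+* ℂ) :
    IsLeast {m : ℕ | ∃ 𝒮 : Finset (Face F), 𝒮.card = m ∧
      ∀ f : Face F, lefChar f.corner (fun _ => ({σ₀} : Finset (F →+* ℂ))) ∈ AddSubgroup.closure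
        {a : Asym F | ∃ g ∈ (𝒮 : Set (Face F)), ∃ σ : F →+* ℂ, a = lefChar g.corner (fun _ => ({σ} : Finset (F →+* ℂ)))}}
      (fibreTwo (conjT : GalT F) conjT_mul_self) := by
  refine FaceTransfer.isLeast_card_faces_hgen_of_intrinsic _ ?_ (fun S₀ hS₀ hS => ?_) σ₀
  · obtain ⟨S, hS, hcard, hgen⟩ := (Dihedral.isLeast_card_gfaces_generate_fibreTwo D conjT_mul_self conjT_ne_one).1
    exact ⟨S, hS, hcard.le, hgen⟩
  · exact fibreTwo_le_card conjT conjT_mul_self D.hcen S₀ (Submodule.span ℤ (pairSet conjT)) le_rfl hS₀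
      (fun y hy => hS (gfaceSet_subset_hodgeSpan conjT conjT_mul_self hy))

/-- **Block currency: EXACTLY `β(F) − 2` generating faces.** [folklore] -/
theorem isLeast_card_faces_hgen_of_dihedral_card_block [IsCMField F] [IsGalois ℚ F] (D : Dihedral.Datum (GalT F) conjT n) (σ₀ : F →+* ℂ) :
    IsLeast {m : ℕ | ∃ 𝒮 : Finset (Face F), 𝒮.card = m ∧
      ∀ f : Face F, lefChar f.corner (fun _ => ({σ₀} : Finset (F →+* ℂ))) ∈ AddSubgroup.closure
        {a : Asym F | ∃ g ∈ (𝒮 : Set (Face F)), ∃ σ : F →+* ℂ, a = lefChar g.corner (fun _ => ({σ} : Finset (F →+* ℂ)))}}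
      (Fintype.card (Block (conjT : GalT F)) - 2) := by
  rw [Dihedral.card_block_eq_fibreTwo_add_two D conjT_mul_self conjT_ne_one, Nat.add_sub_cancel]
  exact isLeast_card_faces_hgen_of_dihedral D σ₀

/-- **Degree `16`, group `D₈` (dihedral datum of level `4`): EXACTLY `22` generating faces.** [folklore] -/
theorem isLeast_card_faces_hgen_twentyTwo [IsCMField F] [IsGalois ℚ F] (D : Dihedral.Datum (GalT F) conjT 4) (σ₀ : F →+* ℂ) :
    IsLeast {m : ℕ | ∃ 𝒮 : Finset (Face F), 𝒮.card = m ∧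
      ∀ f : Face F, lefChar f.corner (fun _ => ({σ₀} : Finset (F →+* ℂ))) ∈ AddSubgroup.closure
        {a : Asym F | ∃ g ∈ (𝒮 : Set (Face F)), ∃ σ : F →+* ℂ, a = lefChar g.corner (fun _ => ({σ} : Finset (F →+* ℂ)))}} 22 := by
  have h := isLeast_card_faces_hgen_of_dihedral D σ₀
  rwa [Dihedral.fibreTwo_eq_twentyTwo conjT_mul_self conjT_ne_one D] at h

/-- **Degree `32`, group `D₁₆` (dihedral datum of level `8`): EXACTLY `2174` generating faces.** [folklore] -/
theorem isLeast_card_faces_hgen_2174 [IsCMField F] [IsGalois ℚ F] (D : Dihedral.Datum (GalT F) conjT 8) (σ₀ : F →+* ℂ) :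
    IsLeast {m : ℕ | ∃ 𝒮 : Finset (Face F), 𝒮.card = m ∧
      ∀ f : Face F, lefChar f.corner (fun _ => ({σ₀} : Finset (F →+* ℂ))) ∈ AddSubgroup.closure
        {a : Asym F | ∃ g ∈ (𝒮 : Set (Face F)), ∃ σ : F →+* ℂ, a = lefChar g.corner (fun _ => ({σ} : Finset (F →+* ℂ)))}} 2174 := by
  have h := isLeast_card_faces_hgen_of_dihedral D σ₀
  rwa [Dihedral.fibreTwo_eq_2174 conjT_mul_self conjT_ne_one D] at h

/-! ## §2 The degree; the datum from the automorphism group -/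

omit [NeZero n] in
/-- **`4n` is the degree of a field with a dihedral datum at level `n`.** [folklore] -/
theorem four_mul_eq_finrank [IsGalois ℚ F] (D : Dihedral.Datum (GalT F) conjT n) : 4 * n = Module.finrank ℚ F := by
  have h := (Subgroup.zpowers D.g).card_mul_index
  rw [Nat.card_zpowers, D.hord, D.hindex, Nat.card_eq_fintype_card, FaceCensus.card_galT] at h
  omega

omit [NeZero n] in
/-- Such a field has degree at least `8` when `n ≥ 2`. [folklore] -/
private theorem eight_le_finrank [IsGalois ℚ F] (D : Dihedral.Datum (GalT F) conjT n) (h2 : 2 ≤ n) : 8 ≤ Module.finrank ℚ F := by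
  rw [← four_mul_eq_finrank D]; omega

/-- **The dihedral datum from an `Aut`-datum.**  An automorphism `g₀` of order `2n` whose `n`-th power induces complex conjugation at `σ₀`, an
automorphism `s₀ ∉ ⟨g₀⟩`, every automorphism outside `⟨g₀⟩` an involution, in a field of degree `4n`, give a dihedral datum on `GalT F` through
`galTOfAut σ₀`. [folklore] -/
theorem exists_datum_of_aut [IsGalois ℚ F] (σ₀ : F →+* ℂ) (g₀ s₀ : F ≃ₐ[ℚ] F) (hord : orderOf g₀ = 2 * n)
    (hcσ : σ₀.comp ((g₀ ^ n : F ≃ₐ[ℚ] F) : F →+* F) = conjugate σ₀) (hs : s₀ ∉ Subgroup.zpowers g₀)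
    (hinvol : ∀ x : F ≃ₐ[ℚ] F, x ∉ Subgroup.zpowers g₀ → x * x = 1) (hdeg : Module.finrank ℚ F = 4 * n) :
    Nonempty (Dihedral.Datum (GalT F) conjT n) := by
  -- the multiplicative equivalence `Aut(F) ≃* GalT F` at `σ₀`
  set e : (F ≃ₐ[ℚ] F) ≃* GalT F := MulEquiv.mk' (galTOfAut σ₀) (galTOfAut_mul σ₀) with he
  have he_apply : ∀ x, e x = galTOfAut σ₀ x := fun x => rfl
  have hmem : ∀ x : F ≃ₐ[ℚ] F, e x ∈ Subgroup.zpowers (e g₀) ↔ x ∈ Subgroup.zpowers g₀ := by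
    intro x
    constructor
    · intro h
      obtain ⟨k, hk⟩ := Subgroup.mem_zpowers_iff.mp h
      rw [← map_zpow, e.apply_eq_iff_eq] at hk
      exact Subgroup.mem_zpowers_iff.mpr ⟨k, hk⟩
    · intro h
      obtain ⟨k, hk⟩ := Subgroup.mem_zpowers_iff.mp h
      exact Subgroup.mem_zpowers_iff.mpr ⟨k, by rw [← map_zpow, hk]⟩
  have hord' : orderOf (e g₀) = 2 * n := by
    rw [← hord]; exact orderOf_injective e.toMonoidHom e.injective g₀
  have hindex : (Subgroup.zpowers (e g₀)).index = 2 := by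
    have h := (Subgroup.zpowers (e g₀)).card_mul_index
    rw [Nat.card_zpowers, hord', Nat.card_eq_fintype_card, FaceCensus.card_galT, hdeg] at h
    have hn : 0 < 2 * n := by have := NeZero.ne n; omega
    have e2 : 2 * n * (Subgroup.zpowers (e g₀)).index = 2 * n * 2 := by rw [h]; ring
    exact Nat.eq_of_mul_eq_mul_left hn e2
  refine ⟨{ g := e g₀, s := e s₀, hgn := ?_, hord := hord', hindex := hindex, hs := fun h => hs ((hmem s₀).mp h), hinvol := ?_ }⟩
  · rw [← map_pow, he_apply]
    exact galTOfAut_conjAut σ₀ hcσ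
  · intro x hx
    obtain ⟨x₀, rfl⟩ := e.surjective x
    rw [← map_mul, hinvol x₀ (fun h => hx ((hmem x₀).mpr h)), map_one]

end Field

/-! ## §3 The Hodge-conjecture reading through the INT2-GEN socket (conditional on the face periods) -/

variable {n : ℕ} [NeZero n]

/-- **HC for the slice of a Galois CM field with dihedral group of order `4n` from `φ₂ = β − 2` face periods** (INT2-GEN socket BY NAME; `n ≥ 2`;
CONDITIONAL on the periods — `HC_CM` is NOT proved): for `K` Galois CM with a dihedral datum on `GalT K` at level `n ≥ 2` there is a face set `𝒮`
with `|𝒮| = φ₂(K) = β(K) − 2` (none fewer can satisfy the generation binder) such that, if every face of `𝒮` has a non-vanishing period on the universe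
of record, the Hodge conjecture holds for every abelian variety dominated by a product of CM abelian varieties with CM by subfields of `K`.
[cite: Shimura1998, §6.2 Theorem 3 and §6.1 Corollary of Theorem 2 (pp. 41–43)] [cite: Pohlmann1968, Thm. 1]
[cite: Milne1999LefschetzClasses, Thm. 3.2 and Cor. 4.5] [cite: MumfordAV1970, §19 Thm. 1 and p. 169] -/
theorem hodgeConjectureFor_of_dihedral_of_exists_facePeriod (K : CMField) [hGal : IsGalois ℚ K]
    (D : Dihedral.Datum (GalT K) conjT n) (h2 : 2 ≤ n) (σ₀ : (K : Type) →+* ℂ) :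
    ∃ 𝒮 : Finset (Face K), 𝒮.card = fibreTwo (conjT : GalT K) conjT_mul_self ∧
      ((∀ f ∈ 𝒮, ∃ ι₁ : K →+* ℂ, f.Admissible ι₁ ∧ ∃ (V : HermSpace3 K ι₁) (σ : K →+* ℂ),
        (Model.picardCMUniverse exists_isReal_hodgeModel_holds hodgePQ_independent_of_hodgeModel_holds
          BallQuotient.ballQuotientUniformised_holds cmAbelianVarietyRealised_holds).PeriodNV ι₁ V K f.psi σ) →
      ∀ {P B : AbelianVariety ℂ}, AbelianVariety.IsProductOf (fun B : AbelianVariety ℂ =>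
        ∃ (E : Type) (_ : Field E) (_ : NumberField E) (_ : IsCMField E) (_ : E →+* (K : Type)) (Φ : CMType E)
          (ι : 𝓞 E →+* End B) (ϑ : E →+* Module.End ℂ (complexBetti B.X 1)),
          IsCMTypeRealisation Φ B ι ϑ) P →
      AVDominatedBy B P → HodgeConjectureFor B.dim B.X) := by
  obtain ⟨⟨𝒮, hcard, hgen⟩, -⟩ := isLeast_card_faces_hgen_of_dihedral (F := K) D σ₀
  refine ⟨𝒮, hcard, fun h P B hP hB => ?_⟩
  have h6 : 6 ≤ Module.finrank ℚ K := le_trans (by norm_num) (eight_le_finrank (F := K) D h2)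
  exact hodgeConjectureFor_of_avDominatedBy_isProductOf_of_exists_facePeriod_on K h6 (𝒮 : Set (Face K)) σ₀ hgen
    (fun f hf => h f (Finset.mem_coe.mp hf)) hP hB

end Summit.HodgeConjecture.CorCM.FaceDihedral

end
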